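import Summits.BirchSwinnertonDyer.BirchSwinnertonDyer.Theorems.SignedLowerHalvesKobayashiMainConjectureSmallImageCM25RecordsF
import Summits.BirchSwinnertonDyer.BirchSwinnertonDyer.Theorems.SignedLowerHalvesSmallImageLowerHalfBothSignsRttTierOneClosure
import Literature.NumberTheory.EllipticCurves.ZywinaCMImageProofs
import Summits.BirchSwinnertonDyer.Rank1Residual.GaloisImage.TorsionIsoImageObstruction
import HarnessLib

/-!
# Route `SignedLowerHalves`, crux L `SmallImageLowerHalfBothSigns` (item stmt-BirchSwinnertonDyer-23599), line `rtt_w3`: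
# tier-T1 RECORDS «CM-25», part 06 — crux L's body at the `p = 3` pairs 333200dz1, 333200ea1, 380894b1 FROM PRINT ONLY

Width seat `bsd-line-slh-p3-w3` g14 under LEAD `cruxlead-stmt-BirchSwinnertonDyer-23599` g3 (cell `bsd-ssimc`); `--supports
stmt-BirchSwinnertonDyer-23599 --as helper`; THEOREMS ONLY; PER PAIR; closes nothing class-wide; BSD is proved for no curve (every
published input is a named-fact HYPOTHESIS).

CENSUS CORRECTION FOR THE LEAD'S BOARD. The line's tier census (cdisprove `T1-CENSUS.md`, from k3-c4 g3 `records.json` + MEMO-3) lists 57 CM-partnered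
pairs at `p = 3` (T1@3, recorded by the LEAD in `…RttTierOneRecords01–15`, print only) and 43 «partnerless» ones (T2@3). But k3-c4 g8/g9 later
established («finding CM-25», `k3c4-MEMO-8.md` §2; kernel Hesse certificates in `…KobayashiMainConjectureSmallImageCM25RecordsA–F`, p499705 …
p500700) that 21 rank-`0` + 1 rank-`1` of those 43 DO have a CM elliptic-curve partner over `ℚ` (the CM curve of the class-number-one shadow field,
`3` inert, or a twist of it; the g3 probe had searched the `j = 1728` family only). So they are TIER T1, and at `p = 3` the LEAD's closure
`forall_kobayashiLowerDivisibility_three_of_cmCurvePartner` (p748602: PRINT ONLY — the floor at `3` is THEOREM B) applies verbatim. This file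
records them for crux L: `∀ ε, KobayashiLowerDivisibility W 3 ε` from the TWELVE published named facts of the cite stub + Vatsal 1999, with the
partner data (models, `#Ẽ(𝔽₃) = 4` counts `card_cm25…`, CM lemma `hasCM_cm25A_…`, the UNCONDITIONAL Hesse / dual-Hesse `3`-congruence
certificate) VERBATIM from k3-c4's landed files (imported / re-checked by `norm_num`); X7, `¬ W.HasCM` and `¬ Surj W 3` (Zywina transported
along the congruence) kernel-decided as in the LEAD's records. Board effect: T2@3 37 → 16 (the 21 here) — resp. 15 with the rank-1 CM-25
pair `380894f1` (sibling part); remaining genuinely partnerless @3 (k3-c4 MEMO-8-addE §5): 414050ca1, 314678ca1 (r1), 219040i1, 270494e1,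
314678bz1/cc1/r1, 378560fp1, 430528v1/y1, 481888n1 (+ g13's unit-partnered five, already recorded).

References: [Kobayashi2003] Conjecture (p. 2), Thm. 7.4; [Fisher2012Hessian] §13, Thm. 13.2; [Cremona2006] Table 1; [Zywina2015] Prop. 1.14;
[SilvermanAEC2009] VII.5 Prop. 5.1, App. C §11; [BDKim2009] Cor. 2.13; [PollackRubin2004] Theorem (p. 448); [Vatsal1999] (1.6), (1.13).
-/

set_option autoImplicit false
-- D-0017: single-problem summit, the namespace repeats the problem name by design.
set_option linter.dupNamespace false
noncomputable section

open scoped Classical MatrixGroups ModularForm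

open CongruenceSubgroup WeierstrassCurve Literature.NumberTheory.EllipticCurves
  Literature.NumberTheory.EllipticCurves.ModularForms
  Literature.NumberTheory.EllipticCurves.Kobayashi2003 ZpExtension
  Literature.NumberTheory.EllipticCurves.GreenbergVatsal2000
  Literature.NumberTheory.EllipticCurves.Rank1Residual
  Literature.NumberTheory.EllipticCurves.Rank1Residual.Typed
  Literature.NumberTheory.EllipticCurves.Rank1Residual.X11RankOneCertificates
  Literature.NumberTheory.EllipticCurves.Fisher2012
  Summit.BirchSwinnertonDyer.BirchSwinnertonDyer.Rank1Residual.IntModel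
  Summit.BirchSwinnertonDyer.BirchSwinnertonDyer.Rank1Residual.X11RankOne
  Summit.BirchSwinnertonDyer.Rank1Residual.X11b
  Summit.BirchSwinnertonDyer.Rank1Residual.X9
  Summit.BirchSwinnertonDyer.Rank1Residual.X1
  Summit.BirchSwinnertonDyer.Rank1Residual.Supersingular

namespace Summit.BirchSwinnertonDyer.BirchSwinnertonDyer.Theorems.SmallImageRttOneSided

/-- **Crux L's body at the CM-25 pair `333200dz1 @ 3` FROM PRINT ONLY** (Cremona model `[0, 0, 0, 137200, 1915998000]`, `N = 333200 = 2⁴·5²·7²·17`, X7 (additive at `2`), `a_3 = 0`, mod-3 image `3Nn`):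
`∀ ε, KobayashiLowerDivisibility W 3 ε` from the cite stub's twelve PUBLISHED named facts + Vatsal 1999, at the CM partner `A` = the twist by `−5` of `49a1` (conductor `19600`; CM by `ℤ[(1+√−7)/2]`, `D = −7`) with the
UNCONDITIONAL `3`-congruence `E` ≅ the member `(700 : 1)` of Fisher's Hesse pencil `X_A(3)` of `A`, `u = 80`(k3-c4 record `…CM25RecordsF`, `kobayashiMainConjecture_c333200dz1_3_of_mu_of_bsdp_cm25`, certificate VERBATIM).
Kernel-decided: `3 ∤ Δ`, `#Ẽ(𝔽₃) = 4` (both; `card_cm25…`), additive at `2` (X7), `j(W) ∉ cmJInvariants`, CM of the partner (`hasCM_cm25A_cmm7_twm5_p3`);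
`¬ Surj W 3` by Zywina transported along the congruence. NO preprint, NO floor, NO `μ`/`L`-value binder, NO descent line. Per pair; CONDITIONAL on print; nothing booked.
[cite: Kobayashi2003, Conjecture (p. 2), Thm. 7.4 (p. 13)] [cite: Fisher2012Hessian, §13 and Thm. 13.2] [cite: Cremona2006, Table 1 (Cremona label 333200dz1)]
[cite: Zywina2015, Prop. 1.14 and Prop. 1.16 (§1.9)] -/
theorem forall_kobayashiLowerDivisibility_c333200dz1_3_of_print_cm25
    (hJ : thm62_63_73_signedColemanKato_zetaJoint) (h12 : thm12_signedSelmerDual_finite_torsion)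
    (h41 : thm41_signedCharIdeal_divisibility)
    (h5 : realPeriodRat_eq_unit_mul_plusPeriod) (h3 : realPeriodRat_eq_unit_mul_plusPeriod_three)
    (hD : Hida2000_thm326_exists_galoisRep) (hC : Carayol1986_artinConductorExponent)
    (hS : ∀ (V : WeierstrassCurve ℚ) (ℓ : ℕ) [Fact ℓ.Prime],
      V.swanConductorAt_rationalTate_eq_wildConductorExponent_of_ringChar_eq_two ℓ)
    (hmod : exists_isNewformOf)
    (hKim : BDKim2009.cor213_signedLambda_add_sum_delta_eq_of_torsionIso)
    (hPR : PollackRubin2004.mainTheorem_signedCharIdeal_eq_of_cm) (hV : vatsal1999_plusSymbol_congruence)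
    (W A : WeierstrassCurve ℚ) [W.IsElliptic] [W.IsGloballyMinimal] [A.IsElliptic] [A.IsGloballyMinimal]
    [Fact (Nat.Prime 3)] (hW : W = ⟨0, 0, 0, 137200, 1915998000⟩) (hA : A = ⟨0, 0, 0, -875, 12250⟩) :
    ∀ ε : ℤˣ, KobayashiLowerDivisibility W 3 ε := by
  have hIW : integralModelInt W = ⟨0, 0, 0, 137200, 1915998000⟩ :=
    integralModelInt_eq_of_map_eq _ (by rw [hW]; ext <;> simp [WeierstrassCurve.map])
  have hIA : integralModelInt A = ⟨0, 0, 0, -875, 12250⟩ :=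
    integralModelInt_eq_of_map_eq _ (by rw [hA]; ext <;> simp [WeierstrassCurve.map])
  have hΔ : (⟨0, 0, 0, 137200, 1915998000⟩ : WeierstrassCurve ℤ).Δ = discOf [0, 0, 0, 137200, 1915998000] :=
    intCurve_Δ 0 0 0 137200 1915998000
  have hΔA : (⟨0, 0, 0, -875, 12250⟩ : WeierstrassCurve ℤ).Δ = discOf [0, 0, 0, -875, 12250] :=
    intCurve_Δ 0 0 0 (-875) 12250
  have hgood : W.HasGoodReductionAtPrime 3 :=
    hasGoodReductionAtPrime_of_not_dvd W 3 (by rw [minimalDiscriminantInt_eq hIW, hΔ]; decide +kernel)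
  have hgoodA : A.HasGoodReductionAtPrime 3 :=
    hasGoodReductionAtPrime_of_not_dvd A 3 (by rw [minimalDiscriminantInt_eq hIA, hΔA]; decide +kernel)
  have hap : W.frobeniusTrace 3 = 0 := by rw [frobeniusTrace_eq hIW card_cm25_333200dz1_3]; norm_num
  have hapA : A.frobeniusTrace 3 = 0 := by rw [frobeniusTrace_eq hIA card_cm25A_cmm7_twm5_p3]; norm_num
  have hc4 : W.c₄ = (-6585600 : ℚ) := by
    subst hW; norm_num [WeierstrassCurve.c₄, WeierstrassCurve.b₂, WeierstrassCurve.b₄]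
  have hc6 : W.c₆ = (-1655422272000 : ℚ) := by
    subst hW; norm_num [WeierstrassCurve.c₆, WeierstrassCurve.b₂, WeierstrassCurve.b₄, WeierstrassCurve.b₆]
  have hc4A : A.c₄ = (42000 : ℚ) := by
    subst hA; norm_num [WeierstrassCurve.c₄, WeierstrassCurve.b₂, WeierstrassCurve.b₄]
  have hc6A : A.c₆ = (-10584000 : ℚ) := by
    subst hA; norm_num [WeierstrassCurve.c₆, WeierstrassCurve.b₂, WeierstrassCurve.b₄, WeierstrassCurve.b₆]
  -- the 3-congruence as a THEOREM: `E` is the member (700 : 1) of the Hesse pencil `X_A(3)` of `A`, scaling `u = 80`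
  have hiso := threeCongruent_of_hesseCertificate_unconditional A W (700 : ℚ) (1 : ℚ) (80 : ℚ)
    (by norm_num) (by rw [hc4A, hc6A, hc4, eval_hesseC4three]; norm_num)
    (by rw [hc4A, hc6A, hc6, eval_hesseC6three]; norm_num)
  -- X7: additive at `2`; `W` non-CM; `¬ Surj W 3` from the CM partner
  have hc₄Z : (⟨0, 0, 0, 137200, 1915998000⟩ : WeierstrassCurve ℤ).c₄ = c4Of [0, 0, 0, 137200, 1915998000] :=
    intCurve_c₄ 0 0 0 137200 1915998000
  have hX : ClassX7 W 3 :=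
    ⟨⟨hgood, by rw [hap]; exact dvd_zero _⟩, not_semistable_of_intModel hIW 2 (by norm_num) (by rw [hΔ]; decide +kernel)
      (by rw [hc₄Z]; decide +kernel)⟩
  have hcm : ¬ W.HasCM := fun h ↦ by
    have hj := (hasCM_iff_j_mem_holds W).mp h
    rw [j_eq_of_intModel 0 0 0 137200 1915998000 hIW] at hj
    exact absurd hj (by decide +kernel)
  have hcmA : A.HasCM := hasCM_cm25A_cmm7_twm5_p3 hIA
  have hs : ¬ Surj W 3 := by
    obtain ⟨e, he⟩ := hiso
    intro hsW
    exact WeierstrassCurve.not_hasSurjectiveModNGaloisRep_of_hasCM A hcmA Nat.prime_three (by norm_num)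
      (Summit.BirchSwinnertonDyer.Rank1Residual.GaloisImage.hasSurjectiveModNGaloisRep_of_torsionIso e he hsW)
  exact forall_kobayashiLowerDivisibility_three_of_cmCurvePartner W A 3 rfl hJ h12 h41 h5 h3 hD hC hS hmod hKim hPR hV
    hX hcm hap hs hcmA ⟨hgoodA, by rw [hapA]; exact dvd_zero _⟩ hapA hiso

/-- **Crux L's body at the CM-25 pair `333200ea1 @ 3` FROM PRINT ONLY** (Cremona model `[0, 0, 0, 169925, -56337750]`, `N = 333200 = 2⁴·5²·7²·17`, X7 (additive at `2`), `a_3 = 0`, mod-3 image `3Nn`):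
`∀ ε, KobayashiLowerDivisibility W 3 ε` from the cite stub's twelve PUBLISHED named facts + Vatsal 1999, at the CM partner `A` = the twist by `−5` of `49a1` (conductor `19600`; CM by `ℤ[(1+√−7)/2]`, `D = −7`) with the
UNCONDITIONAL `3`-congruence `E` ≅ the member `(-260 : 1)` of Fisher's DUAL Hesse pencil `X_A⁻(3)` of `A`, `u = 1/420`(k3-c4 record `…CM25RecordsF`, `kobayashiMainConjecture_c333200ea1_3_of_mu_of_bsdp_cm25`, certificate VERBATIM).
Kernel-decided: `3 ∤ Δ`, `#Ẽ(𝔽₃) = 4` (both; `card_cm25…`), additive at `2` (X7), `j(W) ∉ cmJInvariants`, CM of the partner (`hasCM_cm25A_cmm7_twm5_p3`);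
`¬ Surj W 3` by Zywina transported along the congruence. NO preprint, NO floor, NO `μ`/`L`-value binder, NO descent line. Per pair; CONDITIONAL on print; nothing booked.
[cite: Kobayashi2003, Conjecture (p. 2), Thm. 7.4 (p. 13)] [cite: Fisher2012Hessian, §13 and Thm. 13.2] [cite: Cremona2006, Table 1 (Cremona label 333200ea1)]
[cite: Zywina2015, Prop. 1.14 and Prop. 1.16 (§1.9)] -/
theorem forall_kobayashiLowerDivisibility_c333200ea1_3_of_print_cm25
    (hJ : thm62_63_73_signedColemanKato_zetaJoint) (h12 : thm12_signedSelmerDual_finite_torsion)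
    (h41 : thm41_signedCharIdeal_divisibility)
    (h5 : realPeriodRat_eq_unit_mul_plusPeriod) (h3 : realPeriodRat_eq_unit_mul_plusPeriod_three)
    (hD : Hida2000_thm326_exists_galoisRep) (hC : Carayol1986_artinConductorExponent)
    (hS : ∀ (V : WeierstrassCurve ℚ) (ℓ : ℕ) [Fact ℓ.Prime],
      V.swanConductorAt_rationalTate_eq_wildConductorExponent_of_ringChar_eq_two ℓ)
    (hmod : exists_isNewformOf)
    (hKim : BDKim2009.cor213_signedLambda_add_sum_delta_eq_of_torsionIso)
    (hPR : PollackRubin2004.mainTheorem_signedCharIdeal_eq_of_cm) (hV : vatsal1999_plusSymbol_congruence)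
    (W A : WeierstrassCurve ℚ) [W.IsElliptic] [W.IsGloballyMinimal] [A.IsElliptic] [A.IsGloballyMinimal]
    [Fact (Nat.Prime 3)] (hW : W = ⟨0, 0, 0, 169925, -56337750⟩) (hA : A = ⟨0, 0, 0, -875, 12250⟩) :
    ∀ ε : ℤˣ, KobayashiLowerDivisibility W 3 ε := by
  have hIW : integralModelInt W = ⟨0, 0, 0, 169925, -56337750⟩ :=
    integralModelInt_eq_of_map_eq _ (by rw [hW]; ext <;> simp [WeierstrassCurve.map])
  have hIA : integralModelInt A = ⟨0, 0, 0, -875, 12250⟩ :=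
    integralModelInt_eq_of_map_eq _ (by rw [hA]; ext <;> simp [WeierstrassCurve.map])
  have hΔ : (⟨0, 0, 0, 169925, -56337750⟩ : WeierstrassCurve ℤ).Δ = discOf [0, 0, 0, 169925, -56337750] :=
    intCurve_Δ 0 0 0 169925 (-56337750)
  have hΔA : (⟨0, 0, 0, -875, 12250⟩ : WeierstrassCurve ℤ).Δ = discOf [0, 0, 0, -875, 12250] :=
    intCurve_Δ 0 0 0 (-875) 12250
  have hgood : W.HasGoodReductionAtPrime 3 :=
    hasGoodReductionAtPrime_of_not_dvd W 3 (by rw [minimalDiscriminantInt_eq hIW, hΔ]; decide +kernel)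
  have hgoodA : A.HasGoodReductionAtPrime 3 :=
    hasGoodReductionAtPrime_of_not_dvd A 3 (by rw [minimalDiscriminantInt_eq hIA, hΔA]; decide +kernel)
  have hap : W.frobeniusTrace 3 = 0 := by rw [frobeniusTrace_eq hIW card_cm25_333200ea1_3]; norm_num
  have hapA : A.frobeniusTrace 3 = 0 := by rw [frobeniusTrace_eq hIA card_cm25A_cmm7_twm5_p3]; norm_num
  have hc4 : W.c₄ = (-8156400 : ℚ) := by
    subst hW; norm_num [WeierstrassCurve.c₄, WeierstrassCurve.b₂, WeierstrassCurve.b₄]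
  have hc6 : W.c₆ = (48675816000 : ℚ) := by
    subst hW; norm_num [WeierstrassCurve.c₆, WeierstrassCurve.b₂, WeierstrassCurve.b₄, WeierstrassCurve.b₆]
  have hc4A : A.c₄ = (42000 : ℚ) := by
    subst hA; norm_num [WeierstrassCurve.c₄, WeierstrassCurve.b₂, WeierstrassCurve.b₄]
  have hc6A : A.c₆ = (-10584000 : ℚ) := by
    subst hA; norm_num [WeierstrassCurve.c₆, WeierstrassCurve.b₂, WeierstrassCurve.b₄, WeierstrassCurve.b₆]
  -- the 3-congruence as a THEOREM: `E` is the member (-260 : 1) of the DUAL Hesse pencil `X_A⁻(3)` of `A`, scaling `u = 1/420`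
  have hiso := threeCongruent_of_dualHesseCertificate_unconditional A W (-260 : ℚ) (1 : ℚ) ((1 : ℚ) / 420)
    (by norm_num) (by rw [hc4A, hc6A, hc4, eval_hesseD3]; norm_num)
    (by rw [hc4A, hc6A, hc6, eval_hesseC6three]; norm_num)
  -- X7: additive at `2`; `W` non-CM; `¬ Surj W 3` from the CM partner
  have hc₄Z : (⟨0, 0, 0, 169925, -56337750⟩ : WeierstrassCurve ℤ).c₄ = c4Of [0, 0, 0, 169925, -56337750] :=
    intCurve_c₄ 0 0 0 169925 (-56337750)
  have hX : ClassX7 W 3 :=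
    ⟨⟨hgood, by rw [hap]; exact dvd_zero _⟩, not_semistable_of_intModel hIW 2 (by norm_num) (by rw [hΔ]; decide +kernel)
      (by rw [hc₄Z]; decide +kernel)⟩
  have hcm : ¬ W.HasCM := fun h ↦ by
    have hj := (hasCM_iff_j_mem_holds W).mp h
    rw [j_eq_of_intModel 0 0 0 169925 (-56337750) hIW] at hj
    exact absurd hj (by decide +kernel)
  have hcmA : A.HasCM := hasCM_cm25A_cmm7_twm5_p3 hIA
  have hs : ¬ Surj W 3 := by
    obtain ⟨e, he⟩ := hiso
    intro hsW
    exact WeierstrassCurve.not_hasSurjectiveModNGaloisRep_of_hasCM A hcmA Nat.prime_three (by norm_num)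
      (Summit.BirchSwinnertonDyer.Rank1Residual.GaloisImage.hasSurjectiveModNGaloisRep_of_torsionIso e he hsW)
  exact forall_kobayashiLowerDivisibility_three_of_cmCurvePartner W A 3 rfl hJ h12 h41 h5 h3 hD hC hS hmod hKim hPR hV
    hX hcm hap hs hcmA ⟨hgoodA, by rw [hapA]; exact dvd_zero _⟩ hapA hiso

/-- **Crux L's body at the CM-25 pair `380894b1 @ 3` FROM PRINT ONLY** (Cremona model `[1, -1, 0, 631087, -9018206947]`, `N = 380894 = 2·43²·103`, X7 (additive at `43`), `a_3 = 0`, mod-3 image `3Nn`):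
`∀ ε, KobayashiLowerDivisibility W 3 ε` from the cite stub's twelve PUBLISHED named facts + Vatsal 1999, at the CM partner `A` = `1849a1` (CM by `ℤ[(1+√−43)/2]`, `D = −43`) with the
UNCONDITIONAL `3`-congruence `E` ≅ the member `(2236 : 11)` of Fisher's Hesse pencil `X_A(3)` of `A`, `u = 4/11`(k3-c4 record `…CM25RecordsF`, `kobayashiMainConjecture_c380894b1_3_of_mu_of_bsdp_cm25`, certificate VERBATIM).
Kernel-decided: `3 ∤ Δ`, `#Ẽ(𝔽₃) = 4` (both; `card_cm25…`), additive at `43` (X7), `j(W) ∉ cmJInvariants`, CM of the partner (`hasCM_cm25A_cmm43_tw1_p3`);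
`¬ Surj W 3` by Zywina transported along the congruence. NO preprint, NO floor, NO `μ`/`L`-value binder, NO descent line. Per pair; CONDITIONAL on print; nothing booked.
[cite: Kobayashi2003, Conjecture (p. 2), Thm. 7.4 (p. 13)] [cite: Fisher2012Hessian, §13 and Thm. 13.2] [cite: Cremona2006, Table 1 (Cremona label 380894b1)]
[cite: Zywina2015, Prop. 1.14 and Prop. 1.16 (§1.9)] -/
theorem forall_kobayashiLowerDivisibility_c380894b1_3_of_print_cm25
    (hJ : thm62_63_73_signedColemanKato_zetaJoint) (h12 : thm12_signedSelmerDual_finite_torsion)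
    (h41 : thm41_signedCharIdeal_divisibility)
    (h5 : realPeriodRat_eq_unit_mul_plusPeriod) (h3 : realPeriodRat_eq_unit_mul_plusPeriod_three)
    (hD : Hida2000_thm326_exists_galoisRep) (hC : Carayol1986_artinConductorExponent)
    (hS : ∀ (V : WeierstrassCurve ℚ) (ℓ : ℕ) [Fact ℓ.Prime],
      V.swanConductorAt_rationalTate_eq_wildConductorExponent_of_ringChar_eq_two ℓ)
    (hmod : exists_isNewformOf)
    (hKim : BDKim2009.cor213_signedLambda_add_sum_delta_eq_of_torsionIso)
    (hPR : PollackRubin2004.mainTheorem_signedCharIdeal_eq_of_cm) (hV : vatsal1999_plusSymbol_congruence)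
    (W A : WeierstrassCurve ℚ) [W.IsElliptic] [W.IsGloballyMinimal] [A.IsElliptic] [A.IsGloballyMinimal]
    [Fact (Nat.Prime 3)] (hW : W = ⟨1, -1, 0, 631087, -9018206947⟩) (hA : A = ⟨0, 0, 1, -860, 9707⟩) :
    ∀ ε : ℤˣ, KobayashiLowerDivisibility W 3 ε := by
  have hIW : integralModelInt W = ⟨1, -1, 0, 631087, -9018206947⟩ :=
    integralModelInt_eq_of_map_eq _ (by rw [hW]; ext <;> simp [WeierstrassCurve.map])
  have hIA : integralModelInt A = ⟨0, 0, 1, -860, 9707⟩ :=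
    integralModelInt_eq_of_map_eq _ (by rw [hA]; ext <;> simp [WeierstrassCurve.map])
  have hΔ : (⟨1, -1, 0, 631087, -9018206947⟩ : WeierstrassCurve ℤ).Δ = discOf [1, -1, 0, 631087, -9018206947] :=
    intCurve_Δ 1 (-1) 0 631087 (-9018206947)
  have hΔA : (⟨0, 0, 1, -860, 9707⟩ : WeierstrassCurve ℤ).Δ = discOf [0, 0, 1, -860, 9707] :=
    intCurve_Δ 0 0 1 (-860) 9707
  have hgood : W.HasGoodReductionAtPrime 3 :=
    hasGoodReductionAtPrime_of_not_dvd W 3 (by rw [minimalDiscriminantInt_eq hIW, hΔ]; decide +kernel)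
  have hgoodA : A.HasGoodReductionAtPrime 3 :=
    hasGoodReductionAtPrime_of_not_dvd A 3 (by rw [minimalDiscriminantInt_eq hIA, hΔA]; decide +kernel)
  have hap : W.frobeniusTrace 3 = 0 := by rw [frobeniusTrace_eq hIW card_cm25_380894b1_3]; norm_num
  have hapA : A.frobeniusTrace 3 = 0 := by rw [frobeniusTrace_eq hIA Summit.BirchSwinnertonDyer.Rank1Residual.X12.Records.card_1849a1_mod3]; norm_num
  have hc4 : W.c₄ = (-30292167 : ℚ) := by
    subst hW; norm_num [WeierstrassCurve.c₄, WeierstrassCurve.b₂, WeierstrassCurve.b₄]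
  have hc6 : W.c₆ = (7791594487443 : ℚ) := by
    subst hW; norm_num [WeierstrassCurve.c₆, WeierstrassCurve.b₂, WeierstrassCurve.b₄, WeierstrassCurve.b₆]
  have hc4A : A.c₄ = (41280 : ℚ) := by
    subst hA; norm_num [WeierstrassCurve.c₄, WeierstrassCurve.b₂, WeierstrassCurve.b₄]
  have hc6A : A.c₆ = (-8387064 : ℚ) := by
    subst hA; norm_num [WeierstrassCurve.c₆, WeierstrassCurve.b₂, WeierstrassCurve.b₄, WeierstrassCurve.b₆]
  -- the 3-congruence as a THEOREM: `E` is the member (2236 : 11) of the Hesse pencil `X_A(3)` of `A`, scaling `u = 4/11`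
  have hiso := threeCongruent_of_hesseCertificate_unconditional A W ((2236 : ℚ) / 11) (1 : ℚ) ((4 : ℚ) / 11)
    (by norm_num) (by rw [hc4A, hc6A, hc4, eval_hesseC4three]; norm_num)
    (by rw [hc4A, hc6A, hc6, eval_hesseC6three]; norm_num)
  -- X7: additive at `43`; `W` non-CM; `¬ Surj W 3` from the CM partner
  have hc₄Z : (⟨1, -1, 0, 631087, -9018206947⟩ : WeierstrassCurve ℤ).c₄ = c4Of [1, -1, 0, 631087, -9018206947] :=
    intCurve_c₄ 1 (-1) 0 631087 (-9018206947)
  have hX : ClassX7 W 3 :=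
    ⟨⟨hgood, by rw [hap]; exact dvd_zero _⟩, not_semistable_of_intModel hIW 43 (by norm_num) (by rw [hΔ]; decide +kernel)
      (by rw [hc₄Z]; decide +kernel)⟩
  have hcm : ¬ W.HasCM := fun h ↦ by
    have hj := (hasCM_iff_j_mem_holds W).mp h
    rw [j_eq_of_intModel 1 (-1) 0 631087 (-9018206947) hIW] at hj
    exact absurd hj (by decide +kernel)
  have hcmA : A.HasCM := hasCM_cm25A_cmm43_tw1_p3 hIA
  have hs : ¬ Surj W 3 := by
    obtain ⟨e, he⟩ := hiso
    intro hsW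
    exact WeierstrassCurve.not_hasSurjectiveModNGaloisRep_of_hasCM A hcmA Nat.prime_three (by norm_num)
      (Summit.BirchSwinnertonDyer.Rank1Residual.GaloisImage.hasSurjectiveModNGaloisRep_of_torsionIso e he hsW)
  exact forall_kobayashiLowerDivisibility_three_of_cmCurvePartner W A 3 rfl hJ h12 h41 h5 h3 hD hC hS hmod hKim hPR hV
    hX hcm hap hs hcmA ⟨hgoodA, by rw [hapA]; exact dvd_zero _⟩ hapA hiso

end Summit.BirchSwinnertonDyer.BirchSwinnertonDyer.Theorems.SmallImageRttOneSided

end
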